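import Mathlib
import Summits.Ventures.HodgeRepro.Tier4.Common.AdelicDefs

/-!
# Tier4/Line1/RationalPoints — (I1-a) and (I1-b) of LINE L1: `U(W)(k)` is discrete and closed in `U(W)(𝔸_k)`

Blind re-derivation cell `pub-hodge-repro`, Tier 4 (README §9–§10), seat t4-L1-p5 (prover, LINE L1, gen 0).
Registered statements: `Skeleton.lean` v0.8 (12c8528bc811170c…, 949 l.) L506 `rationalPoints_discrete` and L512
`rationalPoints_closed`, proved here EXACTLY as typed, over typer-2's DEFINED objects (`Tier4/Common/AdelicDefs.lean`: `GA W ≤ GL₄(𝔸_k)` with the units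
topology, `rationalPoints W = principalGL.subgroupOf (unitaryGroup W)`).

THE ARGUMENT (Mathlib only, no printed input): `k` is discrete in `𝔸_k = 𝔸_{k,∞} × 𝔸_{k,f}` — the open set
`U = {‖x_v‖ < 1 at every infinite place} × ∏_v 𝓞_v` meets the principal adeles only in `0`: an `x ∈ k` integral at every
finite place lies in `𝓞_k` (`HeightOneSpectrum.mem_integers_of_valuation_le_one`), and then
`|N_{k/ℚ}(x)| = ∏_v ‖x_v‖^{m_v} < 1` (`InfiniteAdeleRing.coe_norm_eq_abs_norm`) with `N_{k/ℚ}(x) ∈ ℤ`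
(`Algebra.coe_norm_int`) forces `N(x) = 0`, so `x = 0`.  Entrywise, `V = {g ∈ GL₄(𝔸_k) | g_{ij} − δ_{ij} ∈ U}` is a
neighbourhood of `1` meeting the principal subgroup `GL₄(k)` only in `1`; restricted to the subgroup
`rationalPoints W`, the singleton `{1}` is open, and a topological group with `{1}` open is discrete
(`discreteTopology_of_isOpen_singleton_one`).  (I1-b) is then Mathlib's `Subgroup.isClosed_of_discrete` (a discrete
subgroup of a Hausdorff topological group is closed), the Hausdorff property of `𝔸_k` (product of the Hausdorff
`∏_{v | ∞} k_v` and the Hausdorff restricted product `𝔸_{k,f}`) being supplied by hand since Mathlib's `AdeleRing`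
is a `def` that only derives `CommRing`, `TopologicalSpace`, `IsTopologicalRing` and `Algebra`.

Nothing here says anything about the status of the Hodge conjecture for CM abelian varieties, which is NOT proved
(HC_CM is NOT proved by anyone in this repository).
-/

set_option autoImplicit false

noncomputable section

namespace Summit.Ventures.HodgeRepro.Tier4.Line1

open NumberField IsDedekindDomain Topology Common

/-! ## `k` is discrete in `𝔸_k` -/

section AdeleDiscrete

variable (k : Type) [Field k] [NumberField k]

/-- The integral finite adeles `∏_v 𝓞_v` form an open subset of the finite adele ring (each `𝓞_v` is open in `k_v`,
and the restricted product topology makes `∏_v 𝓞_v` open). -/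
theorem isOpen_integralFiniteAdeles :
    IsOpen {a : FiniteAdeleRing (𝓞 k) k |
      ∀ v : HeightOneSpectrum (𝓞 k), a v ∈ v.adicCompletionIntegers k} :=
  RestrictedProduct.isOpen_forall_mem
    (fun v : HeightOneSpectrum (𝓞 k) => Valued.isOpen_valuationSubring (v.adicCompletion k))

/-- The archimedean open box `{x | ‖x_v‖ < 1 for every infinite place v}` is open in `𝔸_{k,∞} = ∏_v k_v`. -/
theorem isOpen_archBox :
    IsOpen {a : InfiniteAdeleRing k | ∀ v : InfinitePlace k, ‖a v‖ < 1} := by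
  have h : {a : InfiniteAdeleRing k | ∀ v : InfinitePlace k, ‖a v‖ < 1} =
      ⋂ v : InfinitePlace k, (fun a : InfiniteAdeleRing k => a v) ⁻¹' Metric.ball 0 1 := by
    ext a
    simp [Metric.mem_ball, dist_zero_right]
  rw [h]
  exact isOpen_iInter_of_finite fun v => Metric.isOpen_ball.preimage (continuous_apply v)

/-- A rational element integral at every finite place is an algebraic integer
(`HeightOneSpectrum.mem_integers_of_valuation_le_one`). -/
theorem exists_ringOfIntegers_of_forall_mem_integers (x : k)
    (h : ∀ v : HeightOneSpectrum (𝓞 k), (x : v.adicCompletion k) ∈ v.adicCompletionIntegers k) :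
    ∃ y : 𝓞 k, (y : k) = x := by
  have h' : ∀ v : HeightOneSpectrum (𝓞 k), v.valuation k x ≤ 1 := fun v => by
    have hv := h v
    rw [HeightOneSpectrum.mem_adicCompletionIntegers,
      HeightOneSpectrum.valuedAdicCompletion_eq_valuation'] at hv
    exact hv
  obtain ⟨y, hy⟩ := HeightOneSpectrum.mem_integers_of_valuation_le_one (R := 𝓞 k) k x h'
  exact ⟨y, hy⟩

/-- An algebraic integer `y` with `‖y‖_v < 1` at every infinite place is `0`: `|N_{k/ℚ}(y)| = ∏_v ‖y‖_v^{m_v} < 1`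
and `N_{k/ℚ}(y) ∈ ℤ`. -/
theorem eq_zero_of_forall_norm_lt_one (y : 𝓞 k)
    (h : ∀ v : InfinitePlace k, ‖((y : k) : v.Completion)‖ < 1) : y = 0 := by
  classical
  have hnorm' : ((|Algebra.norm ℚ (y : k)| : ℚ) : ℝ) < 1 := by
    rw [← InfiniteAdeleRing.coe_norm_eq_abs_norm, InfiniteAdeleRing.norm_def]
    obtain ⟨v₀⟩ := (inferInstance : Nonempty (InfinitePlace k))
    have hle : ∀ v : InfinitePlace k,
        ‖algebraMap k (InfiniteAdeleRing k) (y : k) v‖ ^ v.mult ≤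
          ‖algebraMap k (InfiniteAdeleRing k) (y : k) v‖ := fun v =>
      pow_le_of_le_one (norm_nonneg _) (by simpa using (h v).le) InfinitePlace.mult_ne_zero
    calc ∏ v : InfinitePlace k, ‖algebraMap k (InfiniteAdeleRing k) (y : k) v‖ ^ v.mult
        ≤ ∏ v : InfinitePlace k, ‖algebraMap k (InfiniteAdeleRing k) (y : k) v‖ :=
          Finset.prod_le_prod (fun v _ => by positivity) (fun v _ => hle v)
      _ = ‖algebraMap k (InfiniteAdeleRing k) (y : k) v₀‖ *
          ∏ v ∈ Finset.univ.erase v₀, ‖algebraMap k (InfiniteAdeleRing k) (y : k) v‖ :=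
          (Finset.mul_prod_erase _ _ (Finset.mem_univ v₀)).symm
      _ < 1 := by
          apply mul_lt_one_of_nonneg_of_lt_one_left (norm_nonneg _) (by simpa using h v₀)
          exact Finset.prod_le_one (fun v _ => norm_nonneg _)
            (fun v _ => by simpa using (h v).le)
  have hnorm : |Algebra.norm ℚ (y : k)| < 1 := by exact_mod_cast hnorm'
  have hint : (Algebra.norm ℤ y : ℚ) = Algebra.norm ℚ (y : k) := Algebra.coe_norm_int y
  have habs : |Algebra.norm ℤ y| < 1 := by
    have : ((|Algebra.norm ℤ y| : ℤ) : ℚ) < 1 := by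
      rw [Int.cast_abs, hint]
      exact hnorm
    exact_mod_cast this
  have hz : Algebra.norm ℤ y = 0 := Int.abs_lt_one_iff.1 habs
  exact Algebra.norm_eq_zero_iff.1 hz

/-- **`k` is discrete in `𝔸_k`**: a neighbourhood of `0` meeting the principal adeles only in `0`. -/
theorem exists_nhds_zero_principal :
    ∃ U ∈ 𝓝 (0 : AdeleRing (𝓞 k) k), ∀ x : k, algebraMap k (AdeleRing (𝓞 k) k) x ∈ U → x = 0 := by
  refine ⟨{a : InfiniteAdeleRing k | ∀ v : InfinitePlace k, ‖a v‖ < 1} ×ˢ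
    {a : FiniteAdeleRing (𝓞 k) k | ∀ v : HeightOneSpectrum (𝓞 k), a v ∈ v.adicCompletionIntegers k},
    ?_, ?_⟩
  · apply IsOpen.mem_nhds ((isOpen_archBox k).prod (isOpen_integralFiniteAdeles k))
    refine Set.mem_prod.2 ⟨fun v => ?_, fun v => ?_⟩
    · have h0 : (0 : InfiniteAdeleRing k) v = 0 := rfl
      show ‖(0 : InfiniteAdeleRing k) v‖ < 1
      rw [h0, norm_zero]
      exact zero_lt_one
    · have h0 : (0 : FiniteAdeleRing (𝓞 k) k) v = 0 := rfl
      show (0 : FiniteAdeleRing (𝓞 k) k) v ∈ v.adicCompletionIntegers k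
      rw [h0]
      exact zero_mem _
  · intro x hx
    obtain ⟨h1, h2⟩ := Set.mem_prod.1 hx
    obtain ⟨y, rfl⟩ := exists_ringOfIntegers_of_forall_mem_integers k x
      (fun v => by simpa using h2 v)
    have hy : y = 0 := eq_zero_of_forall_norm_lt_one k y (fun v => by simpa using h1 v)
    rw [hy]
    simp

omit [NumberField k] in
/-- `𝔸_{k,∞} = ∏_{v | ∞} k_v` is Hausdorff (a finite product of normed fields). -/
theorem t2Space_infiniteAdeleRing : T2Space (InfiniteAdeleRing k) :=
  inferInstanceAs (T2Space ((v : InfinitePlace k) → v.Completion))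

open scoped RestrictedProduct in
/-- `𝔸_{k,f}` is Hausdorff (a restricted product of the Hausdorff completions `k_v`). -/
theorem t2Space_finiteAdeleRing : T2Space (FiniteAdeleRing (𝓞 k) k) :=
  inferInstanceAs
    (T2Space (Πʳ v : HeightOneSpectrum (𝓞 k), [v.adicCompletion k, v.adicCompletionIntegers k]))

/-- `𝔸_k = 𝔸_{k,∞} × 𝔸_{k,f}` is Hausdorff. -/
theorem t2Space_adeleRing : T2Space (AdeleRing (𝓞 k) k) :=
  haveI := t2Space_infiniteAdeleRing k
  haveI := t2Space_finiteAdeleRing k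
  inferInstanceAs (T2Space (InfiniteAdeleRing k × FiniteAdeleRing (𝓞 k) k))

end AdeleDiscrete

/-! ## Lift to `GL₄(𝔸_k)` and restriction to `U(W)(k)` -/

section Instance

variable {k : Type} [Field k] [NumberField k] (W : PlaneData k)

/-- A neighbourhood of `1` in `GL₄(𝔸_k)` meeting the principal subgroup `GL₄(k)` only in `1` (entrywise
`g_{ij} − δ_{ij} ∈ U` for the neighbourhood `U` of `0` in `𝔸_k` of `exists_nhds_zero_principal`). -/
theorem exists_nhds_one_principalGL :
    ∃ V ∈ 𝓝 (1 : GL4 k), ∀ g ∈ principalGL (k := k), g ∈ V → g = 1 := by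
  obtain ⟨U, hU, hU0⟩ := exists_nhds_zero_principal k
  refine ⟨{g : GL4 k | ∀ i j, (↑g : M4 k) i j - (1 : M4 k) i j ∈ U}, ?_, ?_⟩
  · have h : {g : GL4 k | ∀ i j, (↑g : M4 k) i j - (1 : M4 k) i j ∈ U} =
        ⋂ i, ⋂ j, (fun g : GL4 k => (↑g : M4 k) i j - (1 : M4 k) i j) ⁻¹' U := by
      ext g
      simp
    rw [h]
    refine Filter.iInter_mem.2 fun i => Filter.iInter_mem.2 fun j => ?_
    have hc : Continuous fun g : GL4 k => (↑g : M4 k) i j - (1 : M4 k) i j :=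
      (Units.continuous_val.matrix_elem i j).sub continuous_const
    have h1 : (fun g : GL4 k => (↑g : M4 k) i j - (1 : M4 k) i j) 1 = 0 := by simp
    have hmem : U ∈ 𝓝 ((fun g : GL4 k => (↑g : M4 k) i j - (1 : M4 k) i j) 1) := by
      rw [h1]
      exact hU
    exact hc.continuousAt.preimage_mem_nhds hmem
  · rintro g ⟨A, rfl⟩ hg
    have hA : ∀ i j, (A : Matrix (Fin 4) (Fin 4) k) i j = (1 : Matrix (Fin 4) (Fin 4) k) i j := by
      intro i j
      have hij := hg i j
      have e : (↑(Matrix.GeneralLinearGroup.map (algebraMap k (Ad k)) A) : M4 k) i j - (1 : M4 k) i j =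
          algebraMap k (Ad k) ((A : Matrix (Fin 4) (Fin 4) k) i j - (1 : Matrix (Fin 4) (Fin 4) k) i j) := by
        rw [map_sub]
        congr 1
        rw [Matrix.one_apply, Matrix.one_apply]
        split_ifs <;> simp
      rw [e] at hij
      exact sub_eq_zero.1 (hU0 _ hij)
    have hA1 : A = 1 := Units.ext (Matrix.ext fun i j => hA i j)
    rw [hA1, map_one]

/-- (I1-a, LINE L1, Skeleton.lean L506): **`U(W)(k)` is discrete in `U(W)(𝔸_k)`** — the singleton `{1}` of the
subgroup `rationalPoints W` is the trace of the neighbourhood `V` of `exists_nhds_one_principalGL`, hence open. -/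
theorem rationalPoints_discrete : DiscreteTopology (rationalPoints W) := by
  obtain ⟨V, hV, hV1⟩ := exists_nhds_one_principalGL (k := k)
  apply discreteTopology_of_isOpen_singleton_one
  have hcont : Continuous fun h : rationalPoints W => ((h : GA W) : GL4 k) :=
    continuous_subtype_val.comp continuous_subtype_val
  have hopen : IsOpen ((fun h : rationalPoints W => ((h : GA W) : GL4 k)) ⁻¹' interior V) :=
    isOpen_interior.preimage hcont
  convert hopen using 1
  ext h
  simp only [Set.mem_singleton_iff, Set.mem_preimage]
  constructor
  · rintro rfl
    exact mem_interior_iff_mem_nhds.2 hV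
  · intro hh
    have hmem : ((h : GA W) : GL4 k) ∈ principalGL (k := k) := h.2
    have h1 : ((h : GA W) : GL4 k) = 1 := hV1 _ hmem (interior_subset hh)
    exact Subtype.ext (Subtype.ext h1)

/-- `U(W)(𝔸_k) ≤ GL₄(𝔸_k)` is Hausdorff (units of the Hausdorff ring `M₄(𝔸_k)`, then a subspace). -/
theorem t2Space_GA : T2Space (GA W) := by
  haveI := t2Space_adeleRing k
  infer_instance

/-- (I1-b, LINE L1, Skeleton.lean L512): **`U(W)(k)` is closed in `U(W)(𝔸_k)`** — a discrete subgroup of a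
Hausdorff topological group is closed (`Subgroup.isClosed_of_discrete`), with (I1-a) and `t2Space_GA`. -/
theorem rationalPoints_closed : IsClosed ((rationalPoints W : Subgroup (GA W)) : Set (GA W)) := by
  haveI := t2Space_GA W
  haveI := rationalPoints_discrete W
  exact Subgroup.isClosed_of_discrete

end Instance

end Summit.Ventures.HodgeRepro.Tier4.Line1

end
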